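import Literature.Analysis.FluidPDE.OseenHeatSemigroup
import Literature.Analysis.FluidPDE.HelmholtzAnnihilator
import HarnessLib

/-!
# Pairing identities for the Oseen–heat operator `𝒩_τ = e^{τΔ} P ∇·`

Analysis/FluidPDE support file, first layer of the discharge of the named fact
`Literature.Analysis.FluidPDE.classical_of_bounded_mild_L3` (`MildL3Smooth.lean`: bounded mild
solutions of the Navier–Stokes equations in `C([0,T); L³)` are classical; Lemarié-Rieusset 2016,
Thm. 9.12; Koch–Nadirashvili–Seregin–Šverák 2009, §4). The tree realises the Duhamel integrand
`e^{τΔ} P ∇·F` of a bounded matrix field `F = (Fⱼₖ)` in physical space as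
`oseenHeat τ F i = ∑ⱼ ∂ⱼ e^{τΔ} Fⱼᵢ + ∑ⱼₖ ∫₀^∞ ∂ᵢ∂ⱼ∂ₖ e^{(τ+σ)Δ} Fⱼₖ dσ` (`OseenHeat.lean`,
`OseenHeatSemigroup.lean`). This file proves the two identities which say that this *is* the
right operator for the duality (very weak) formulation of mild solutions
(`Fluid.IsMildNSSolutionBetween`):

* **adjoint identity** (`integral_sum_oseenHeat_mul_inner_eq`): for a smooth compactly supported
  divergence-free test field `φ`,
  `∫ ∑ᵢ (𝒩_τ F)ᵢ φᵢ = -∑ᵢⱼ ∫ Fⱼᵢ ∂ⱼ (e^{τΔ} φ)ᵢ`,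
  i.e. `⟨e^{τΔ}P∇·F, φ⟩ = -⟨F, ∇ e^{τΔ} φ⟩` (the Leray correction pairs to zero against
  divergence-free fields);
* the layerwise tools for the companion statement that `𝒩_τ F` is weakly divergence free
  (`∫ ∑ᵢ (𝒩_τ F)ᵢ ∂ᵢθ = 0`, sibling file `OseenHeatDivFree.lean`).

These are Fubini computations: the layers `∂ᵥ e^{aΔ}` are convolutions with the *odd* kernels
`∂ᵥ G_a`, hence skew-adjoint (`integral_heatD1_mul_eq_neg_integral`,
`integral_heatD3_mul_eq_neg_integral`, from the tree's
`UnboundedOperators.integral_convolution_mul_eq`), derivatives fall on smooth compactly supported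
test data (`heatD3_eq_heatExtension`), the sum over the frame collapses the innermost derivative,
`∑ᵢ ∂ₖ∂ⱼ∂ᵢ e^{sΔ} φᵢ = ∂ₖ∂ⱼ e^{sΔ} (div φ)` (`sum_heatD3_frame_eq_heatD2`), and the Leray
correction is paired with an `L¹` function by Fubini in `(σ, x)`
(`integral_integral_Ioi_heatD3_mul_eq`, dominated by `162 (τ+σ)^{-3/2} ‖F‖_∞ |h|`). Dimension
three is assumed where the tree's kernel bounds are (`hE : finrank ℝ E = 3`). Everything is
proved; no definitions.

These are the identities behind "mild ⇔ very weak in the classes used" (Lemarié-Rieusset 2016,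
Thm. 6.1 / Prop. 6.5, §6.2 for the Oseen tensor; Fabes–Jones–Rivière 1972, Thm. 2.1;
Koch–Nadirashvili–Seregin–Šverák 2009, §3 (the kernel `K_{ijk}` of `S(t)P∂ₖ`)).

## Mathlib / tree search

Tree: `heatD1_eq_convolution`, `heatD3_eq_heatD1_heatD1_heatD1`, `memLp_heatD1`,
`eLpNorm_heatD1_le_dim3`, `norm_heatD3_le_of_top`, `aestronglyMeasurable_heatD3_const_add`,
`integrableOn_const_mul_rpow_const_add`, `memLp_top_integral_Ioi_heatD3` (`OseenHeat*`);
`UnboundedOperators.integral_convolution_mul_eq`, `integrable_kernel_mul_mul`,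
`fderiv_heatKernel_neg_apply`, `fderiv_heatExtension_apply_of_hasCompactSupport`,
`hasDerivAt_heatExtension_time_of_hasCompactSupport`, `laplacian_heatExtension_of_hasCompactSupport`
(`UnboundedOperators/Heat*`); `fderiv_fderiv_apply_comm`, `fderiv_laplacian_apply`
(`HelmholtzAnnihilator`); `divergence_eq_sum_inner_fderiv` (`VectorCalculus`). Mathlib:
`integral_prod`, `integral_integral_swap`, `intervalIntegral_tendsto_integral_Ioi`,
`intervalIntegral.integral_eq_sub_of_hasDerivAt`. `lean search 'oseenHeat.*inner|oseenHeat.*div'`: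
nothing prior.

## References

* P. G. Lemarié-Rieusset, *The Navier–Stokes Problem in the 21st Century*, CRC Press 2016,
  §6.2 (Oseen tensor), Thm. 6.1 and Prop. 6.5 (mild = very weak), Thm. 9.12. [LemarieRieusset2016]
* G. Koch, N. Nadirashvili, G. Seregin, V. Šverák, Acta Math. 203 (2009) = arXiv:0709.3599, §3
  (representation formula with the kernel `K_{ijk} = ∂ₖK_{ij}`), §4. [KochNadirashviliSereginSverak2009]
* E. B. Fabes, B. F. Jones, N. M. Rivière, Arch. Rational Mech. Anal. 45 (1972), Thm. 2.1.
  [FabesJonesRiviere1972]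
-/

open MeasureTheory Filter Set InnerProductSpace intervalIntegral
open scoped Real ENNReal NNReal Convolution Laplacian RealInnerProductSpace Topology

noncomputable section

namespace Literature.Analysis.FluidPDE

variable {E : Type*} [NormedAddCommGroup E] [InnerProductSpace ℝ E] [FiniteDimensional ℝ E]
  [MeasurableSpace E] [BorelSpace E]

/-! ## Skew-adjointness of the heat-flow derivative layers -/

section Transpose

/-- **`∂ᵥ e^{aΔ}` is skew-adjoint**: `∫ (∂ᵥ e^{aΔ} F) h = -∫ F (∂ᵥ e^{aΔ} h)` for `F ∈ L^∞`,
`h ∈ L¹`, `a > 0` (both sides are the pairing of `F` and `h` through the odd kernel `∂ᵥ G_a`;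
Fubini). [folklore] -/
theorem integral_heatD1_mul_eq_neg_integral {F h : E → ℝ} (hF : MemLp F ∞ volume)
    (hh : Integrable h) {a : ℝ} (ha : 0 < a) (v : E) :
    ∫ x, heatD1 a v F x * h x = -∫ x, F x * heatD1 a v h x := by
  have hh1 : MemLp h 1 volume := memLp_one_iff_integrable.2 hh
  set K : E → ℝ := fun z => fderiv ℝ (UnboundedOperators.heatKernel (E := E) a) z v with hK
  have hKodd : ∀ z, K (-z) = (-1) * K z := fun z => by
    simp only [hK, UnboundedOperators.fderiv_heatKernel_neg_apply, neg_mul, one_mul]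
  have hK1 : Integrable K := UnboundedOperators.integrable_fderiv_heatKernel_apply ha v
  have hKq : MemLp K 1 volume := memLp_one_iff_integrable.2 hK1
  haveI : ENNReal.HolderConjugate (∞ : ℝ≥0∞) 1 := ENNReal.HolderConjugate.symm
  have hint := UnboundedOperators.integrable_kernel_mul_mul hK1 (p := ∞) (q := 1) hKq hF hh1
  rw [heatD1_eq_convolution hF le_top ha v, heatD1_eq_convolution hh1 le_rfl ha v,
    UnboundedOperators.integral_convolution_mul_eq hKodd hint, neg_one_mul]

/-- **`∂ᵤ∂ᵥ∂_w e^{sΔ}` is skew-adjoint with reversed order**: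
`∫ (∂ᵤ∂ᵥ∂_w e^{sΔ} F) h = -∫ F (∂_w∂ᵥ∂ᵤ e^{sΔ} h)` for `F ∈ L^∞`, `h ∈ L¹`, `s > 0`
(three layers at the clock `s/3`). [folklore] -/
theorem integral_heatD3_mul_eq_neg_integral {F h : E → ℝ} (hF : MemLp F ∞ volume)
    (hh : Integrable h) {s : ℝ} (hs : 0 < s) (u v w : E) :
    ∫ x, heatD3 s u v w F x * h x = -∫ x, F x * heatD3 s w v u h x := by
  have hh1 : MemLp h 1 volume := memLp_one_iff_integrable.2 hh
  have h3 : 0 < s / 3 := by positivity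
  have hs3 : s = s / 3 + s / 3 + s / 3 := by ring
  rw [hs3, heatD3_eq_heatD1_heatD1_heatD1 hF le_top h3 h3 h3 u v w,
    heatD3_eq_heatD1_heatD1_heatD1 hh1 le_rfl h3 h3 h3 w v u]
  have hG1 : MemLp (heatD1 (s / 3) w F) ∞ volume := memLp_heatD1 hF le_top h3 w
  have hG2 : MemLp (heatD1 (s / 3) v (heatD1 (s / 3) w F)) ∞ volume := memLp_heatD1 hG1 le_top h3 v
  have hh₁ : Integrable (heatD1 (s / 3) u h) :=
    memLp_one_iff_integrable.1 (memLp_heatD1 hh1 le_rfl h3 u)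
  have hh₂ : Integrable (heatD1 (s / 3) v (heatD1 (s / 3) u h)) :=
    memLp_one_iff_integrable.1 (memLp_heatD1 (memLp_one_iff_integrable.2 hh₁) le_rfl h3 v)
  rw [integral_heatD1_mul_eq_neg_integral hG2 hh h3 u,
    integral_heatD1_mul_eq_neg_integral hG1 hh₁ h3 v,
    integral_heatD1_mul_eq_neg_integral hF hh₂ h3 w]
  ring

end Transpose

/-! ## Derivatives fall on smooth compactly supported test data -/

section TestData

omit [FiniteDimensional ℝ E] [MeasurableSpace E] [BorelSpace E] in
/-- A directional derivative of a `C^{n+1}` function is `C^n`. [folklore] -/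
theorem contDiff_fderiv_apply_const_of_succ {θ : E → ℝ} {n : ℕ} (hθ : ContDiff ℝ (n + 1 : ℕ) θ)
    (u : E) : ContDiff ℝ n fun z => fderiv ℝ θ z u :=
  (hθ.fderiv_right (m := n) (by norm_cast)).clm_apply contDiff_const

/-- `∂ᵤ e^{sΔ} θ = e^{sΔ} ∂ᵤθ` for `θ ∈ C¹_c` (as functions). [folklore] -/
theorem heatD1_eq_heatExtension {θ : E → ℝ} (hθ : ContDiff ℝ 1 θ) (hc : HasCompactSupport θ)
    (s : ℝ) (u : E) :
    heatD1 s u θ = UnboundedOperators.heatExtension (fun z => fderiv ℝ θ z u) s :=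
  funext fun x => UnboundedOperators.fderiv_heatExtension_apply_of_hasCompactSupport hθ hc s x u

/-- `∂ᵥ∂ᵤ e^{sΔ} θ = e^{sΔ} ∂ᵥ∂ᵤθ` for `θ ∈ C²_c` (as functions). [folklore] -/
theorem heatD2_eq_heatExtension {θ : E → ℝ} (hθ : ContDiff ℝ 2 θ) (hc : HasCompactSupport θ)
    (s : ℝ) (u v : E) :
    heatD2 s v u θ =
      UnboundedOperators.heatExtension (fun z => fderiv ℝ (fun y => fderiv ℝ θ y u) z v) s := by
  have hθu : ContDiff ℝ 1 fun z => fderiv ℝ θ z u := contDiff_fderiv_apply_const_of_succ hθ u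
  funext x
  unfold heatD2
  rw [show (fun y => fderiv ℝ (UnboundedOperators.heatExtension θ s) y u) =
      UnboundedOperators.heatExtension (fun z => fderiv ℝ θ z u) s from
    heatD1_eq_heatExtension (hθ.of_le one_le_two) hc s u]
  exact UnboundedOperators.fderiv_heatExtension_apply_of_hasCompactSupport hθu
    (hc.fderiv_apply ℝ u) s x v

/-- `∂_w∂ᵥ∂ᵤ e^{sΔ} θ = e^{sΔ} ∂_w∂ᵥ∂ᵤθ` for `θ ∈ C³_c` (as functions). [folklore] -/
theorem heatD3_eq_heatExtension {θ : E → ℝ} (hθ : ContDiff ℝ 3 θ) (hc : HasCompactSupport θ)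
    (s : ℝ) (u v w : E) :
    heatD3 s w v u θ = UnboundedOperators.heatExtension
      (fun z => fderiv ℝ (fun y => fderiv ℝ (fun y' => fderiv ℝ θ y' u) y v) z w) s := by
  have hθu : ContDiff ℝ 2 fun z => fderiv ℝ θ z u := contDiff_fderiv_apply_const_of_succ hθ u
  have hθuv : ContDiff ℝ 1 fun z => fderiv ℝ (fun y => fderiv ℝ θ y u) z v :=
    contDiff_fderiv_apply_const_of_succ hθu v
  funext x
  unfold heatD3
  have h2 : (fun z => fderiv ℝ (fun y => fderiv ℝ (UnboundedOperators.heatExtension θ s) y u) z v) =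
      UnboundedOperators.heatExtension (fun z => fderiv ℝ (fun y => fderiv ℝ θ y u) z v) s :=
    heatD2_eq_heatExtension (hθ.of_le (by norm_num)) hc s u v
  rw [h2]
  exact UnboundedOperators.fderiv_heatExtension_apply_of_hasCompactSupport hθuv
    ((hc.fderiv_apply ℝ u).fderiv_apply ℝ v) s x w

/-- **The sum over the frame collapses the innermost derivative**: if
`∑ᵢ ∂_{bᵢ} hᵢ = D` pointwise for `C³_c` functions `hᵢ` and a `C²_c` function `D`, then
`∑ᵢ ∂ₖ∂ⱼ∂ᵢ e^{sΔ} hᵢ = ∂ₖ∂ⱼ e^{sΔ} D` (for `φ` divergence free and `hᵢ = φᵢ`: `D = div φ = 0`;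
for `hᵢ = ∂ᵢθ`: `D = Δθ`). [folklore] -/
theorem sum_heatD3_frame_eq_heatD2 {ι : Type*} [Fintype ι] {e : ι → E} {h : ι → E → ℝ}
    (hh : ∀ i, ContDiff ℝ 3 (h i)) (hhc : ∀ i, HasCompactSupport (h i)) {D : E → ℝ}
    (hD : ContDiff ℝ 2 D) (hDc : HasCompactSupport D)
    (hsum : ∀ y, ∑ i, fderiv ℝ (h i) y (e i) = D y) (s : ℝ) (v w x : E) :
    ∑ i, heatD3 s w v (e i) (h i) x = heatD2 s w v D x := by
  -- derivatives on the data
  have hD3 : ∀ i, heatD3 s w v (e i) (h i) x = UnboundedOperators.heatExtension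
      (fun z => fderiv ℝ (fun y => fderiv ℝ (fun y' => fderiv ℝ (h i) y' (e i)) y v) z w) s x :=
    fun i => by rw [heatD3_eq_heatExtension (hh i) (hhc i) s (e i) v w]
  simp_rw [hD3]
  rw [heatD2_eq_heatExtension hD hDc s v w]
  -- regularity of the layers
  have h1 : ∀ i, ContDiff ℝ 2 fun y' => fderiv ℝ (h i) y' (e i) := fun i =>
    contDiff_fderiv_apply_const_of_succ (hh i) (e i)
  have h2 : ∀ i, ContDiff ℝ 1 fun y => fderiv ℝ (fun y' => fderiv ℝ (h i) y' (e i)) y v := fun i =>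
    contDiff_fderiv_apply_const_of_succ (h1 i) v
  have hc2 : ∀ i, HasCompactSupport fun y => fderiv ℝ (fun y' => fderiv ℝ (h i) y' (e i)) y v :=
    fun i => ((hhc i).fderiv_apply ℝ (e i)).fderiv_apply ℝ v
  -- the pointwise identity `∑ᵢ ∂_w∂ᵥ∂ᵢ hᵢ = ∂_w∂ᵥ D`
  have hsum' : (fun y => ∑ i, fderiv ℝ (h i) y (e i)) = D := funext hsum
  have hDv : ∀ y, ∑ i, fderiv ℝ (fun y' => fderiv ℝ (h i) y' (e i)) y v = fderiv ℝ D y v := by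
    intro y
    rw [← hsum', fderiv_fun_sum fun i _ => (h1 i).differentiable (by norm_num) y]
    simp
  have hDvw : ∀ z, ∑ i, fderiv ℝ (fun y => fderiv ℝ (fun y' => fderiv ℝ (h i) y' (e i)) y v) z w =
      fderiv ℝ (fun y => fderiv ℝ D y v) z w := by
    intro z
    have hfun : (fun y => fderiv ℝ D y v) =
        fun y => ∑ i, fderiv ℝ (fun y' => fderiv ℝ (h i) y' (e i)) y v := funext fun y => (hDv y).symm
    rw [hfun, fderiv_fun_sum fun i _ => (h2 i).differentiable one_ne_zero z]
    simp
  rw [← UnboundedOperators.heatExtension_finset_sum]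
  · congr 1
    funext z
    simpa using hDvw z
  · intro i _
    exact UnboundedOperators.integrable_heatKernel_smul_comp_sub
      ((h2 i).continuous_fderiv one_ne_zero |>.clm_apply continuous_const) ((hc2 i).fderiv_apply ℝ w) s x

end TestData

/-! ## Components of test fields along the frame -/

section Components

omit [FiniteDimensional ℝ E] [MeasurableSpace E] [BorelSpace E] in
/-- The components `φᵢ = ⟪φ, bᵢ⟫` of a smooth field are smooth. [folklore] -/
theorem contDiff_inner_const_of_contDiff {φ : E → E} {n : WithTop ℕ∞} (hφ : ContDiff ℝ n φ)
    (c : E) : ContDiff ℝ n fun x => ⟪φ x, c⟫ :=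
  hφ.inner ℝ contDiff_const

omit [InnerProductSpace ℝ E] [FiniteDimensional ℝ E] [MeasurableSpace E] [BorelSpace E] in
/-- The components of a compactly supported field are compactly supported. [folklore] -/
theorem hasCompactSupport_inner_const {E' : Type*} [NormedAddCommGroup E'] [InnerProductSpace ℝ E']
    {X : Type*} [TopologicalSpace X] {φ : X → E'} (hφ : HasCompactSupport φ) (c : E') :
    HasCompactSupport fun x => ⟪φ x, c⟫ :=
  hφ.comp_left (g := fun w : E' => ⟪w, c⟫) (inner_zero_left c)

omit [FiniteDimensional ℝ E] [MeasurableSpace E] [BorelSpace E] in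
/-- `∂ᵥ ⟪φ, c⟫ = ⟪∂ᵥ φ, c⟫` (a private copy of `DivCurlL2.fderiv_inner_const_apply`, whose
module is not imported here). [folklore] -/
private theorem fderiv_inner_const_apply_aux {φ : E → E} {y : E} (hφ : DifferentiableAt ℝ φ y) (c v : E) :
    fderiv ℝ (fun x => ⟪φ x, c⟫) y v = ⟪fderiv ℝ φ y v, c⟫ := by
  rw [fderiv_inner_apply ℝ hφ (differentiableAt_const c)]
  simp

omit [MeasurableSpace E] [BorelSpace E] in
/-- **`∑ᵢ ∂ᵢ φᵢ = div φ`** along the frame `bᵢ = stdOrthonormalBasis`. [folklore] -/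
theorem sum_fderiv_inner_frame_eq_divergence {φ : E → E} {y : E} (hφ : DifferentiableAt ℝ φ y) :
    ∑ i, fderiv ℝ (fun x => ⟪φ x, stdOrthonormalBasis ℝ E i⟫) y (stdOrthonormalBasis ℝ E i) =
      VectorCalculus.divergence φ y := by
  rw [divergence_eq_sum_inner_fderiv (stdOrthonormalBasis ℝ E)]
  exact Finset.sum_congr rfl fun i _ => by
    rw [fderiv_inner_const_apply_aux hφ, real_inner_comm]

end Components

/-! ## The adjoint identity against divergence-free test fields -/

section Adjoint

variable {F : Fin (Module.finrank ℝ E) → Fin (Module.finrank ℝ E) → E → ℝ}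

/-- **The Leray correction pairs to zero against divergence-free fields, layerwise**: for
`F ∈ L^∞`, `s > 0`, a smooth compactly supported divergence-free `φ` and frame indices `j, k`,
`∑ᵢ ∫ (∂ᵢ∂ⱼ∂ₖ e^{sΔ} Fⱼₖ) φᵢ = -∫ Fⱼₖ ∂ₖ∂ⱼ e^{sΔ}(div φ) = 0`. [folklore] -/
theorem sum_integral_heatD3_mul_inner_eq_zero (hF : ∀ j k, MemLp (F j k) ∞ volume) {s : ℝ}
    (hs : 0 < s) {φ : E → E} (hφ : FunctionSpaces.IsTestFunctionOn (⊤ : TopologicalSpace.Opens E) φ)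
    (hdiv : VectorCalculus.IsDivFree φ) (j k : Fin (Module.finrank ℝ E)) :
    ∑ i, ∫ x, heatD3 s (stdOrthonormalBasis ℝ E i) (stdOrthonormalBasis ℝ E j)
      (stdOrthonormalBasis ℝ E k) (F j k) x * ⟪φ x, stdOrthonormalBasis ℝ E i⟫ = 0 := by
  set b := stdOrthonormalBasis ℝ E with hb
  have hφs : ∀ i, ContDiff ℝ 3 fun x => ⟪φ x, b i⟫ := fun i =>
    contDiff_infty.1 (contDiff_inner_const_of_contDiff hφ.contDiff (b i)) 3
  have hφc : ∀ i, HasCompactSupport fun x => ⟪φ x, b i⟫ := fun i =>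
    hasCompactSupport_inner_const hφ.hasCompactSupport (b i)
  have hφi : ∀ i, Integrable fun x => ⟪φ x, b i⟫ := fun i =>
    (hφs i).continuous.integrable_of_hasCompactSupport (hφc i)
  -- transpose each layer
  have hT : ∀ i, ∫ x, heatD3 s (b i) (b j) (b k) (F j k) x * ⟪φ x, b i⟫ =
      -∫ x, F j k x * heatD3 s (b k) (b j) (b i) (fun y => ⟪φ y, b i⟫) x := fun i =>
    integral_heatD3_mul_eq_neg_integral (hF j k) (hφi i) hs (b i) (b j) (b k)
  have hint : ∀ i ∈ Finset.univ, Integrable (fun x => F j k x *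
      heatD3 s (b k) (b j) (b i) (fun y => ⟪φ y, b i⟫) x) volume := by
    intro i _
    have h1 : Integrable (heatD3 s (b k) (b j) (b i) (fun y => ⟪φ y, b i⟫)) :=
      memLp_one_iff_integrable.1 (memLp_heatD3 (memLp_one_iff_integrable.2 (hφi i)) le_rfl hs _ _ _)
    exact h1.mul_of_top_right (hF j k)
  simp_rw [hT]
  rw [Finset.sum_neg_distrib, neg_eq_zero, ← MeasureTheory.integral_finsetSum _ hint]
  · -- collapse the sum over `i`: `∑ᵢ ∂ₖ∂ⱼ∂ᵢ e^{sΔ} φᵢ = ∂ₖ∂ⱼ e^{sΔ} (div φ) = 0`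
    have hsum : ∀ y, ∑ i, fderiv ℝ (fun x => ⟪φ x, b i⟫) y (b i) = (fun _ : E => (0 : ℝ)) y :=
      fun y => (sum_fderiv_inner_frame_eq_divergence
        ((hφ.contDiff.differentiable (by simp)).differentiableAt)).trans (hdiv y)
    have hcollapse : ∀ x, ∑ i, heatD3 s (b k) (b j) (b i) (fun y => ⟪φ y, b i⟫) x =
        heatD2 s (b k) (b j) (fun _ : E => (0 : ℝ)) x := fun x =>
      sum_heatD3_frame_eq_heatD2 (e := ⇑b) hφs hφc contDiff_const
        HasCompactSupport.zero hsum s (b j) (b k) x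
    have hzero : heatD2 s (b k) (b j) (fun _ : E => (0 : ℝ)) = 0 := by
      funext x
      simp [heatD2, UnboundedOperators.heatExtension_zero_fun]
    have : (fun x => ∑ i, F j k x * heatD3 s (b k) (b j) (b i) (fun y => ⟪φ y, b i⟫) x) = 0 := by
      funext x
      rw [← Finset.mul_sum, hcollapse x, hzero]
      simp
    rw [this]
    simp

variable (hE : Module.finrank ℝ E = 3)
include hE

/-- **Fubini for the Leray-correction layer paired with an `L¹` function**: for `F ∈ L^∞`,
`h ∈ L¹`, `τ > 0`,
`∫ (∫₀^∞ ∂ᵢ∂ⱼ∂ₖ e^{(τ+σ)Δ} F dσ) h = ∫₀^∞ (∫ (∂ᵢ∂ⱼ∂ₖ e^{(τ+σ)Δ} F) h) dσ`, the double integrand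
being dominated by `162 (τ+σ)^{-3/2} ‖F‖_∞ |h|`; together with the integrability of the inner
pairing in `σ`. [folklore] -/
theorem integral_integral_Ioi_heatD3_mul_eq {G : E → ℝ} (hG : MemLp G ∞ volume) {τ : ℝ}
    (hτ : 0 < τ) {h : E → ℝ} (hh : Integrable h) (i j k : Fin (Module.finrank ℝ E)) :
    Integrable (fun σ => ∫ x, heatD3 (τ + σ) (stdOrthonormalBasis ℝ E i)
        (stdOrthonormalBasis ℝ E j) (stdOrthonormalBasis ℝ E k) G x * h x)
        (volume.restrict (Ioi 0)) ∧
      ∫ x, (∫ σ in Ioi (0 : ℝ), heatD3 (τ + σ) (stdOrthonormalBasis ℝ E i)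
        (stdOrthonormalBasis ℝ E j) (stdOrthonormalBasis ℝ E k) G x) * h x =
      ∫ σ in Ioi (0 : ℝ), ∫ x, heatD3 (τ + σ) (stdOrthonormalBasis ℝ E i)
        (stdOrthonormalBasis ℝ E j) (stdOrthonormalBasis ℝ E k) G x * h x := by
  set b := stdOrthonormalBasis ℝ E with hb
  set H : ℝ → E → ℝ := fun σ y => heatD3 (τ + σ) (b i) (b j) (b k) G y with hH
  -- the double integrand `(y, σ) ↦ H σ y * h y` is integrable
  have hdom : Integrable (fun z : E × ℝ => ‖h z.1‖ *
      (162 * (eLpNorm G ∞ volume).toReal * (τ + z.2) ^ (-(3 / 2 : ℝ))))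
      ((volume : Measure E).prod (volume.restrict (Ioi (0:ℝ)))) :=
    hh.norm.mul_prod (integrableOn_const_mul_rpow_const_add hτ (by norm_num : (1:ℝ) < 3 / 2) _)
  have hmeasH : AEStronglyMeasurable (fun z : E × ℝ => H z.2 z.1)
      ((volume : Measure E).prod (volume.restrict (Ioi (0:ℝ)))) :=
    (aestronglyMeasurable_heatD3_const_add hG le_top hτ (b i) (b j) (b k)).prod_swap
  have hmeash : AEStronglyMeasurable (fun z : E × ℝ => h z.1)
      ((volume : Measure E).prod (volume.restrict (Ioi (0:ℝ)))) := hh.aestronglyMeasurable.comp_fst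
  have hint : Integrable (Function.uncurry fun (y : E) (σ : ℝ) => H σ y * h y)
      ((volume : Measure E).prod (volume.restrict (Ioi (0:ℝ)))) := by
    refine hdom.mono' (hmeasH.mul hmeash) ?_
    have hae : ∀ᵐ z : E × ℝ ∂((volume : Measure E).prod (volume.restrict (Ioi (0:ℝ)))), 0 < z.2 :=
      Measure.quasiMeasurePreserving_snd.ae (ae_restrict_mem measurableSet_Ioi)
    filter_upwards [hae] with z hz
    change ‖H z.2 z.1 * h z.1‖ ≤ _
    rw [norm_mul, mul_comm]
    refine mul_le_mul_of_nonneg_left ?_ (norm_nonneg _)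
    have hz' : (0 : ℝ) < z.2 := hz
    have hσ' : 0 < τ + z.2 := by linarith
    calc ‖H z.2 z.1‖ ≤ 162 * (τ + z.2) ^ (-(3 / 2 : ℝ)) * (eLpNorm G ∞ volume).toReal :=
          norm_heatD3_le_of_top hE hG hσ' i j k z.1
      _ = _ := by ring
  refine ⟨hint.integral_prod_right, ?_⟩
  -- Fubini
  have hswap := integral_integral_swap hint
  calc ∫ y, (∫ σ in Ioi (0:ℝ), H σ y) * h y
      = ∫ y, ∫ σ in Ioi (0:ℝ), H σ y * h y := by
        simp_rw [← MeasureTheory.integral_mul_const]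
    _ = ∫ σ in Ioi (0:ℝ), ∫ y, H σ y * h y := hswap

/-- **The adjoint identity of the Oseen–heat operator against divergence-free test fields**:
for a bounded matrix field `F`, `τ > 0` and a smooth compactly supported divergence-free `φ`,
`∫ ∑ᵢ (𝒩_τ F)ᵢ φᵢ = -∑ᵢⱼ ∫ Fⱼᵢ ∂ⱼ e^{τΔ} φᵢ`, i.e. `⟨e^{τΔ} P ∇·F, φ⟩ = -⟨F, ∇ e^{τΔ} φ⟩`
(`P` is symmetric with `Pφ = φ`, `e^{τΔ}` is symmetric, and both commute with `∇·`): the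
first-order layers transpose (`integral_heatD1_mul_eq_neg_integral`) and the Leray correction
pairs to `∂ₖ∂ⱼ e^{sΔ} (div φ) = 0` (`sum_integral_heatD3_mul_inner_eq_zero`). This is the identity
by which the Oseen/Duhamel formula `u(t) = e^{ν(t-s)Δ}u(s) - ∫ₛᵗ 𝒩_{ν(t-τ)}(u ⊗ u) dτ` reproduces
the duality form `∫⟪u(t), φ⟫ = ∫⟪u(s), e^{ν(t-s)Δ}φ⟫ + ∫ₛᵗ∫⟪u, (u·∇)e^{ν(t-τ)Δ}φ⟫`
(Lemarié-Rieusset 2016, Thm. 6.1 / Prop. 6.5: mild = very weak; §6.2, the Oseen tensor).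
[cite: LemarieRieusset2016, Thm. 6.1 / Prop. 6.5 and §6.2] -/
theorem integral_sum_oseenHeat_mul_inner_eq (hF : ∀ j k, MemLp (F j k) ∞ volume) {τ : ℝ}
    (hτ : 0 < τ) {φ : E → E} (hφ : FunctionSpaces.IsTestFunctionOn (⊤ : TopologicalSpace.Opens E) φ)
    (hdiv : VectorCalculus.IsDivFree φ) :
    ∫ x, ∑ i, oseenHeat τ F i x * ⟪φ x, stdOrthonormalBasis ℝ E i⟫ =
      -∑ i, ∑ j, ∫ x, F j i x *
        heatD1 τ (stdOrthonormalBasis ℝ E j) (fun y => ⟪φ y, stdOrthonormalBasis ℝ E i⟫) x := by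
  set b := stdOrthonormalBasis ℝ E with hb
  have hφs : ∀ i, ContDiff ℝ 3 fun x => ⟪φ x, b i⟫ := fun i =>
    contDiff_infty.1 (contDiff_inner_const_of_contDiff hφ.contDiff (b i)) 3
  have hφc : ∀ i, HasCompactSupport fun x => ⟪φ x, b i⟫ := fun i =>
    hasCompactSupport_inner_const hφ.hasCompactSupport (b i)
  have hφi : ∀ i, Integrable fun x => ⟪φ x, b i⟫ := fun i =>
    (hφs i).continuous.integrable_of_hasCompactSupport (hφc i)
  -- integrability of the pieces
  have hA : ∀ i j, Integrable (fun x => heatD1 τ (b j) (F j i) x * ⟪φ x, b i⟫) := fun i j =>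
    (hφi i).mul_of_top_right (memLp_heatD1 (hF j i) le_top hτ (b j))
  have hB : ∀ i j k, Integrable (fun x => (∫ σ in Ioi (0:ℝ),
      heatD3 (τ + σ) (b i) (b j) (b k) (F j k) x) * ⟪φ x, b i⟫) := fun i j k =>
    (hφi i).mul_of_top_right (memLp_top_integral_Ioi_heatD3 hE (hF j k) hτ i j k)
  have hBsum : ∀ i j, Integrable (fun x => ∑ k, (∫ σ in Ioi (0:ℝ),
      heatD3 (τ + σ) (b i) (b j) (b k) (F j k) x) * ⟪φ x, b i⟫) := fun i j =>
    integrable_finsetSum _ fun k _ => hB i j k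
  -- expand `oseenHeat` and distribute the integral
  have hsplit : ∀ i, ∫ x, oseenHeat τ F i x * ⟪φ x, b i⟫ =
      (∑ j, ∫ x, heatD1 τ (b j) (F j i) x * ⟪φ x, b i⟫) +
        ∑ j, ∑ k, ∫ x, (∫ σ in Ioi (0:ℝ), heatD3 (τ + σ) (b i) (b j) (b k) (F j k) x) *
          ⟪φ x, b i⟫ := by
    intro i
    have hpt : ∀ x, oseenHeat τ F i x * ⟪φ x, b i⟫ =
        (∑ j, heatD1 τ (b j) (F j i) x * ⟪φ x, b i⟫) +
          ∑ j, ∑ k, (∫ σ in Ioi (0:ℝ), heatD3 (τ + σ) (b i) (b j) (b k) (F j k) x) *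
            ⟪φ x, b i⟫ := fun x => by
      simp only [oseenHeat, hb, add_mul, Finset.sum_mul]
    simp_rw [hpt]
    rw [integral_add (integrable_finsetSum _ fun j _ => hA i j)
      (integrable_finsetSum _ fun j _ => hBsum i j),
      MeasureTheory.integral_finsetSum _ fun j _ => hA i j,
      MeasureTheory.integral_finsetSum _ fun j _ => hBsum i j]
    congr 1
    exact Finset.sum_congr rfl fun j _ => MeasureTheory.integral_finsetSum _ fun k _ => hB i j k
  have hOi : ∀ i, Integrable (fun x => oseenHeat τ F i x * ⟪φ x, b i⟫) := fun i =>
    (hφi i).mul_of_top_right (memLp_top_oseenHeat hE hF hτ i)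
  rw [MeasureTheory.integral_finsetSum _ fun i _ => hOi i]
  simp_rw [hsplit]
  rw [Finset.sum_add_distrib]
  -- the first-order layers transpose
  have hT1 : ∀ i j, ∫ x, heatD1 τ (b j) (F j i) x * ⟪φ x, b i⟫ =
      -∫ x, F j i x * heatD1 τ (b j) (fun y => ⟪φ y, b i⟫) x := fun i j =>
    integral_heatD1_mul_eq_neg_integral (hF j i) (hφi i) hτ (b j)
  simp_rw [hT1]
  have hneg : (∑ i, ∑ j, -∫ x, F j i x * heatD1 τ (b j) (fun y => ⟪φ y, b i⟫) x) =
      -∑ i, ∑ j, ∫ x, F j i x * heatD1 τ (b j) (fun y => ⟪φ y, b i⟫) x := by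
    simp only [Finset.sum_neg_distrib]
  rw [hneg, add_eq_left]
  · -- the Leray correction pairs to zero: Fubini in `(σ, x)` and the layerwise cancellation
    have hFub : ∀ i j k, ∫ x, (∫ σ in Ioi (0:ℝ), heatD3 (τ + σ) (b i) (b j) (b k) (F j k) x) *
        ⟪φ x, b i⟫ = ∫ σ in Ioi (0:ℝ), ∫ x, heatD3 (τ + σ) (b i) (b j) (b k) (F j k) x *
          ⟪φ x, b i⟫ := fun i j k =>
      (integral_integral_Ioi_heatD3_mul_eq hE (hF j k) hτ (hφi i) i j k).2
    have hJ : ∀ i j k, Integrable (fun σ => ∫ x, heatD3 (τ + σ) (b i) (b j) (b k) (F j k) x *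
        ⟪φ x, b i⟫) (volume.restrict (Ioi 0)) := fun i j k =>
      (integral_integral_Ioi_heatD3_mul_eq hE (hF j k) hτ (hφi i) i j k).1
    simp_rw [hFub]
    rw [Finset.sum_comm]
    refine Finset.sum_eq_zero fun j _ => ?_
    rw [Finset.sum_comm]
    refine Finset.sum_eq_zero fun k _ => ?_
    rw [← MeasureTheory.integral_finsetSum _ fun i _ => hJ i j k]
    refine (setIntegral_congr_fun measurableSet_Ioi fun σ hσ => ?_).trans
      (MeasureTheory.integral_zero _ _)
    have hσ' : (0 : ℝ) < σ := hσ
    exact sum_integral_heatD3_mul_inner_eq_zero hF (by linarith) hφ hdiv j k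

end Adjoint

/-! ## Weak divergence-freeness of `𝒩_τ F`: layer tools -/

section DivFreeTools

omit [InnerProductSpace ℝ E] [FiniteDimensional ℝ E] [MeasurableSpace E] [BorelSpace E] in
/-- A finite sum of compactly supported functions is compactly supported. [folklore] -/
private theorem hasCompactSupport_finsetSum {E' : Type*} [TopologicalSpace E'] {ι : Type*}
    (s : Finset ι) {f : ι → E' → ℝ} (h : ∀ i ∈ s, HasCompactSupport (f i)) :
    HasCompactSupport fun x => ∑ i ∈ s, f i x := by
  classical
  induction s using Finset.induction_on with
  | empty =>
    simp only [Finset.sum_empty]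
    exact (HasCompactSupport.zero : HasCompactSupport (0 : E' → ℝ))
  | insert a s ha ih =>
    simp_rw [Finset.sum_insert ha]
    exact (h a (Finset.mem_insert_self a s)).add
      (ih fun i hi => h i (Finset.mem_insert_of_mem hi))

omit [MeasurableSpace E] [BorelSpace E] in
/-- The Laplacian of a smooth function is smooth (frame-sum representation; a private copy of
the tree's `contDiff_laplacian`, whose module is not imported here). [folklore] -/
private theorem contDiff_laplacian_aux {θ : E → ℝ} (hθ : ContDiff ℝ ((⊤ : ℕ∞) : WithTop ℕ∞) θ)
    (n : ℕ) :
    ContDiff ℝ n (Δ θ) := by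
  have h2 : ContDiff ℝ 2 θ := contDiff_infty.1 hθ 2
  have hn : ContDiff ℝ (n + 2 : ℕ) θ := contDiff_infty.1 hθ (n + 2)
  rw [show (Δ θ) = fun y => ∑ i, fderiv ℝ (fun y' => fderiv ℝ θ y' (stdOrthonormalBasis ℝ E i))
      y (stdOrthonormalBasis ℝ E i) from funext (laplacian_eq_sum_fderiv_fderiv _ h2)]
  refine ContDiff.sum fun i _ => ?_
  have h1 : ContDiff ℝ (n + 1 : ℕ) fun y' => fderiv ℝ θ y' (stdOrthonormalBasis ℝ E i) :=
    contDiff_fderiv_apply_const_of_succ (n := n + 1) hn _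
  exact contDiff_fderiv_apply_const_of_succ h1 _

omit [MeasurableSpace E] [BorelSpace E] in
/-- The Laplacian of a compactly supported `C²` function is compactly supported (a private copy
of the tree's `hasCompactSupport_laplacian`). [folklore] -/
private theorem hasCompactSupport_laplacian_aux {θ : E → ℝ} (hθ : ContDiff ℝ 2 θ)
    (hc : HasCompactSupport θ) : HasCompactSupport (Δ θ) := by
  rw [show (Δ θ) = fun y => ∑ i, fderiv ℝ (fun y' => fderiv ℝ θ y' (stdOrthonormalBasis ℝ E i))
      y (stdOrthonormalBasis ℝ E i) from funext (laplacian_eq_sum_fderiv_fderiv _ hθ)]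
  exact hasCompactSupport_finsetSum _ fun i _ => (hc.fderiv_apply ℝ _).fderiv_apply ℝ _

/-- Symmetry of the second heat-flow layer on test data: `∂ᵤ∂ᵥ e^{sΔ}θ = ∂ᵥ∂ᵤ e^{sΔ}θ`.
[folklore] -/
theorem heatD2_comm_of_test {θ : E → ℝ} (hθ : ContDiff ℝ 2 θ) (hc : HasCompactSupport θ)
    (s : ℝ) (u v x : E) : heatD2 s u v θ x = heatD2 s v u θ x := by
  unfold heatD2
  exact fderiv_fderiv_apply_comm
    (UnboundedOperators.contDiff_heatExtension_of_hasCompactSupport hθ hc s) x u v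

/-- `∂ⱼ e^{sΔ} (∂ᵢθ) = ∂ⱼ∂ᵢ e^{sΔ} θ` for a `C¹_c` test function. [folklore] -/
theorem heatD1_fderiv_eq_heatD2 {θ : E → ℝ} (hθ : ContDiff ℝ 1 θ) (hc : HasCompactSupport θ)
    (s : ℝ) (u v : E) :
    heatD1 s v (fun y => fderiv ℝ θ y u) = heatD2 s v u θ := by
  funext x
  unfold heatD1 heatD2
  rw [← heatD1_eq_heatExtension hθ hc s u]
  rfl

variable {F : Fin (Module.finrank ℝ E) → Fin (Module.finrank ℝ E) → E → ℝ}

/-- **The Leray-correction layer against a gradient**: for `F ∈ L^∞`, `s > 0`, a smooth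
compactly supported `θ` and frame indices `j, k`,
`∑ᵢ ∫ (∂ᵢ∂ⱼ∂ₖ e^{sΔ} Fⱼₖ) ∂ᵢθ = -∫ Fⱼₖ ∂ₖ∂ⱼ e^{sΔ} (Δθ)`. [folklore] -/
theorem sum_integral_heatD3_mul_fderiv_eq (hF : ∀ j k, MemLp (F j k) ∞ volume) {s : ℝ}
    (hs : 0 < s) {θ : E → ℝ} (hθ : FunctionSpaces.IsTestFunctionOn (⊤ : TopologicalSpace.Opens E) θ)
    (j k : Fin (Module.finrank ℝ E)) :
    ∑ i, ∫ x, heatD3 s (stdOrthonormalBasis ℝ E i) (stdOrthonormalBasis ℝ E j)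
      (stdOrthonormalBasis ℝ E k) (F j k) x * fderiv ℝ θ x (stdOrthonormalBasis ℝ E i) =
      -∫ x, F j k x * heatD2 s (stdOrthonormalBasis ℝ E k) (stdOrthonormalBasis ℝ E j) (Δ θ) x := by
  set b := stdOrthonormalBasis ℝ E with hb
  have hθ2 : ContDiff ℝ 2 θ := contDiff_infty.1 hθ.contDiff 2
  have hθ4 : ContDiff ℝ 4 θ := contDiff_infty.1 hθ.contDiff 4
  have hhs : ∀ i, ContDiff ℝ 3 fun x => fderiv ℝ θ x (b i) := fun i =>
    contDiff_fderiv_apply_const_of_succ hθ4 (b i)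
  have hhc : ∀ i, HasCompactSupport fun x => fderiv ℝ θ x (b i) := fun i =>
    hθ.hasCompactSupport.fderiv_apply ℝ (b i)
  have hhi : ∀ i, Integrable fun x => fderiv ℝ θ x (b i) := fun i =>
    (hhs i).continuous.integrable_of_hasCompactSupport (hhc i)
  -- transpose each layer
  have hT : ∀ i, ∫ x, heatD3 s (b i) (b j) (b k) (F j k) x * fderiv ℝ θ x (b i) =
      -∫ x, F j k x * heatD3 s (b k) (b j) (b i) (fun y => fderiv ℝ θ y (b i)) x := fun i =>
    integral_heatD3_mul_eq_neg_integral (hF j k) (hhi i) hs (b i) (b j) (b k)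
  have hint : ∀ i ∈ Finset.univ, Integrable (fun x => F j k x *
      heatD3 s (b k) (b j) (b i) (fun y => fderiv ℝ θ y (b i)) x) volume := by
    intro i _
    have h1 : Integrable (heatD3 s (b k) (b j) (b i) (fun y => fderiv ℝ θ y (b i))) :=
      memLp_one_iff_integrable.1 (memLp_heatD3 (memLp_one_iff_integrable.2 (hhi i)) le_rfl hs _ _ _)
    exact h1.mul_of_top_right (hF j k)
  simp_rw [hT]
  rw [Finset.sum_neg_distrib, ← MeasureTheory.integral_finsetSum _ hint]
  congr 1
  refine integral_congr_ae (Eventually.of_forall fun x => ?_)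
  -- collapse the sum over `i`: `∑ᵢ ∂ₖ∂ⱼ∂ᵢ e^{sΔ} ∂ᵢθ = ∂ₖ∂ⱼ e^{sΔ} (Δ θ)`
  have hsum : ∀ y, ∑ i, fderiv ℝ (fun x => fderiv ℝ θ x (b i)) y (b i) = (Δ θ) y :=
    fun y => (laplacian_eq_sum_fderiv_fderiv b hθ2 y).symm
  have hcollapse := sum_heatD3_frame_eq_heatD2 (e := ⇑b) hhs hhc
    (contDiff_laplacian_aux hθ.contDiff 2) (hasCompactSupport_laplacian_aux hθ2 hθ.hasCompactSupport)
    hsum s (b j) (b k) x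
  dsimp only
  rw [← Finset.mul_sum, hcollapse]

end DivFreeTools

end Literature.Analysis.FluidPDE
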